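import Summits.ResolutionOfSingularities.ResolutionOfSingularities.Theorems.PurelyInseparableDim4PureLeafUnitDivergence
import Summits.ResolutionOfSingularities.ResolutionOfSingularities.Theorems.PurelyInseparableDim4WinCertF
import HarnessLib
import HarnessLib.Audit.Tags

/-!
# Purely inseparable fourfolds — the divergent family is a TRAP of the PLAIN global game over `𝔽₂`
# (cell res-dim4-pi; companion of `…PureLeafUnitDivergence`: not only MODE 1h, EVERY choice of permissible centre is answered)
# [OURS · counted 0 · a theorem about OUR coordinate-centre frame v4, not about resolution]

Width seat `res-dim4-p-10` (g3).  At a state `F m = x₁·(x₃ + ⋯ + x₃^{m+1} + x₀ + x₀²x₃^m + x₀²x₃^{m+1})` of the divergent branch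
(`…PureLeafUnitDivergence`) the permissible coordinate centres are EXACTLY `{x₀,x₁,x₃}` and the point `{x₀,x₁,x₂,x₃}`
(`isPermissibleCentre_F_iff`), and the reply «chart `x₃`, `b = (1,0,0,0)`» answers BOTH with the cleaned transform `F (m+1)`
(`step_univ_F`; the point chart law agrees with the `{x₀,x₁,x₃}` law because no monomial involves `x₂`).  Hence the set
`{⟨F m, 0, exc⟩}` is a TRAP SET of the plain game (`isTrapSet_family`) and

* **`not_stateWins_F`** — `¬ StateWins 2 ⟨F m, r, exc⟩` over `𝔽₂` for every `m` and EVERY booking: player A has NO winning strategy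
  of coordinate centres against `𝔽₂`-rational replies from these states (a LOCATED TRAP of the plain global game at `(2,2)`);
* the trap is entered from the `d = 0` leaf `x₀x₁x₂x₃(1+x₀)` in two edges (`…UnitDivergence.step1h_leaf/prefix`), although that leaf
  itself is NOT claimed lost (A may open with another pair).

HONEST SCOPE: the `2`-fold locus of `z² + F m` contains the NON-coordinate component `V(x₁, x₃ + ⋯)` through the origin, so these states
are presumably OUT of coordinate scope (`InCoordinateScope`, not decided here) — this is a statement about the PLAIN game `StateWins`, not about
F4-C(2,2)'s in-scope game.  Nothing here proves or refutes resolution of singularities in dim ≥ 4 / char `p`; counted 0; AI work, weaker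
than expert review. bears_on: LADDER-RESOLUTION:D157-DOOR2 (res-dim4-pi · brick (i) · plain-game trap). Supports
stmt-ResolutionOfSingularities-16155 (helper).
-/

set_option linter.dupNamespace false

open MvPolynomial Finset

open scoped BigOperators

noncomputable section

namespace Summit.ResolutionOfSingularities.ResolutionOfSingularities.Theorems.PIDim4

namespace UnitDivergence

open Literature.AlgebraicGeometry.Resolution
open Literature.AlgebraicGeometry.Resolution.Hauser2010
open CentreBlowup StepKit PthPowerFactor

/-! ## 1. The permissible centres at `F m` -/

/-- **At `F m` a coordinate centre is permissible iff it contains `{x₀, x₁, x₃}`.** [folklore] -/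
theorem isPermissibleCentre_F_iff (m : ℕ) (S : Finset (Fin 4)) :
    IsPermissibleCentre 2 S
        (X 1 * ((∑ t ∈ Finset.range (m + 1), X 3 ^ (t + 1)) + X 0 + X 0 ^ 2 * X 3 ^ m + X 0 ^ 2 * X 3 ^ (m + 1)) :
          MvPolynomial (Fin 4) (ZMod 2)) ↔
      ({0, 1, 3} : Finset (Fin 4)) ⊆ S := by
  constructor
  · rintro ⟨-, hord⟩
    have hb := le_trans hord (ordAlong_le_of_coeff_ne_zero (S := S) (by rw [(coeff_F m).1]; exact one_ne_zero))
    have ha := le_trans hord (ordAlong_le_of_coeff_ne_zero (S := S) (by rw [(coeff_F m).2]; exact one_ne_zero))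
    have hb' : 2 ≤ degIn S (Finsupp.single 0 1 + Finsupp.single 1 1 : Fin 4 →₀ ℕ) := by exact_mod_cast hb
    have ha' : 2 ≤ degIn S (Finsupp.single 1 1 + Finsupp.single 3 1 : Fin 4 →₀ ℕ) := by exact_mod_cast ha
    have hadd : ∀ u v : Fin 4 →₀ ℕ, degIn S (u + v) = degIn S u + degIn S v := fun u v => by
      simp only [degIn, Finsupp.coe_add, Pi.add_apply, Finset.sum_add_distrib]
    rw [hadd, degIn_single, degIn_single] at hb' ha'
    have h0 : (0 : Fin 4) ∈ S := by by_contra h; rw [if_neg h] at hb'; split_ifs at hb'; all_goals omega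
    have h1 : (1 : Fin 4) ∈ S := by by_contra h; rw [if_neg h] at hb'; split_ifs at hb'; all_goals omega
    have h3 : (3 : Fin 4) ∈ S := by by_contra h; rw [if_neg h] at ha'; split_ifs at ha'; all_goals omega
    intro x hx
    simp only [Finset.mem_insert, Finset.mem_singleton] at hx
    rcases hx with rfl | rfl | rfl
    · exact h0
    · exact h1
    · exact h3
  · intro hS
    refine ⟨⟨0, hS (by decide)⟩, le_trans ?_ (ordAlong_mono hS _)⟩
    rw [ordAlong_S_F]
    exact le_rfl

/-- Hence the permissible centres at `F m` are `{x₀,x₁,x₃}` and the point. [folklore] -/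
theorem eq_of_isPermissibleCentre_F (m : ℕ) {S : Finset (Fin 4)}
    (hS : IsPermissibleCentre 2 S
      (X 1 * ((∑ t ∈ Finset.range (m + 1), X 3 ^ (t + 1)) + X 0 + X 0 ^ 2 * X 3 ^ m + X 0 ^ 2 * X 3 ^ (m + 1)) :
        MvPolynomial (Fin 4) (ZMod 2))) :
    S = {0, 1, 3} ∨ S = Finset.univ := by
  have hsub := (isPermissibleCentre_F_iff m S).mp hS
  by_cases h2 : (2 : Fin 4) ∈ S
  · right
    ext x
    simp only [Finset.mem_univ, iff_true]
    fin_cases x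
    · exact hsub (by decide)
    · exact hsub (by decide)
    · exact h2
    · exact hsub (by decide)
  · left
    refine le_antisymm (fun x hx => ?_) hsub
    fin_cases x
    · decide
    · decide
    · exact absurd hx h2
    · decide

/-! ## 2. The point blow-up is answered the same way -/

/-- On `F m` the point chart `x₃` coincides with the `{x₀,x₁,x₃}` chart `x₃` (no monomial involves `x₂`). [folklore] -/
theorem chartTransform_univ_F (m : ℕ) :
    chartTransform 2 (Finset.univ : Finset (Fin 4)) 3
      (X 1 * ((∑ t ∈ Finset.range (m + 1), X 3 ^ (t + 1)) + X 0 + X 0 ^ 2 * X 3 ^ m + X 0 ^ 2 * X 3 ^ (m + 1)) :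
        MvPolynomial (Fin 4) (ZMod 2)) =
    chartTransform 2 ({0, 1, 3} : Finset (Fin 4)) 3
      (X 1 * ((∑ t ∈ Finset.range (m + 1), X 3 ^ (t + 1)) + X 0 + X 0 ^ 2 * X 3 ^ m + X 0 ^ 2 * X 3 ^ (m + 1))) := by
  unfold chartTransform
  refine Finset.sum_congr rfl fun d hd => ?_
  have h2 : d 2 = 0 := by
    rcases mem_support_F m hd with ⟨t, -, rfl⟩ | rfl | rfl | rfl <;> simp
  have hdeg : degIn (Finset.univ : Finset (Fin 4)) d = degIn ({0, 1, 3} : Finset (Fin 4)) d := by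
    unfold degIn
    rw [Fin.sum_univ_four, Finset.sum_insert (by decide), Finset.sum_insert (by decide), Finset.sum_singleton, h2]
    ring
  have hce : chartExponent 2 (Finset.univ : Finset (Fin 4)) 3 d = chartExponent 2 ({0, 1, 3} : Finset (Fin 4)) 3 d := by
    rw [chartExponent_eq_iff]
    refine ⟨by rw [chartExponent_apply_self, hdeg], fun i hi => chartExponent_apply_of_ne 2 _ hi d⟩
  rw [hce]

/-- `ord₀ F m = 2` (as an order along the point). [folklore] -/
theorem ordAlong_univ_F (m : ℕ) :
    ordAlong (Finset.univ : Finset (Fin 4))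
      (X 1 * ((∑ t ∈ Finset.range (m + 1), X 3 ^ (t + 1)) + X 0 + X 0 ^ 2 * X 3 ^ m + X 0 ^ 2 * X 3 ^ (m + 1)) :
        MvPolynomial (Fin 4) (ZMod 2)) = 2 := by
  refine le_antisymm ?_ (le_trans (by rw [ordAlong_S_F]) (ordAlong_mono (Finset.subset_univ ({0, 1, 3} : Finset (Fin 4))) _))
  have h := ordAlong_le_of_coeff_ne_zero (S := (Finset.univ : Finset (Fin 4))) (d := Finsupp.single 0 1 + Finsupp.single 1 1)
    (F := (X 1 * ((∑ t ∈ Finset.range (m + 1), X 3 ^ (t + 1)) + X 0 + X 0 ^ 2 * X 3 ^ m + X 0 ^ 2 * X 3 ^ (m + 1)) :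
      MvPolynomial (Fin 4) (ZMod 2))) (by rw [(coeff_F m).1]; exact one_ne_zero)
  rw [degIn_univ] at h
  simpa [map_add, Finsupp.degree_single] using h

/-- **The point blow-up, chart `x₃`, `b = (1,0,0,0)`, also leads to `F (m+1)`** (books: `r = 0` stays, `exc ↦ insert x₃ (exc ∖ {x₀})`).
[folklore] -/
theorem step_univ_F (m : ℕ) (exc : Finset (Fin 4)) :
    step 2 (Finset.univ : Finset (Fin 4)) 3 (fun i => if i = 0 then 1 else 0)
      (⟨X 1 * ((∑ t ∈ Finset.range (m + 1), X 3 ^ (t + 1)) + X 0 + X 0 ^ 2 * X 3 ^ m + X 0 ^ 2 * X 3 ^ (m + 1)), 0, exc⟩ :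
        State (ZMod 2)) =
      ⟨X 1 * ((∑ t ∈ Finset.range (m + 2), X 3 ^ (t + 1)) + X 0 + X 0 ^ 2 * X 3 ^ (m + 1) + X 0 ^ 2 * X 3 ^ (m + 2)), 0,
        insert 3 (exc.filter fun i => (if i = (0 : Fin 4) then (1 : ZMod 2) else 0) = 0)⟩ := by
  have hpt : pointTransform 2 (Finset.univ : Finset (Fin 4)) 3 (fun i => if i = 0 then 1 else 0)
      (⟨X 1 * ((∑ t ∈ Finset.range (m + 1), X 3 ^ (t + 1)) + X 0 + X 0 ^ 2 * X 3 ^ m + X 0 ^ 2 * X 3 ^ (m + 1)), 0, exc⟩ :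
        State (ZMod 2)) =
      pointTransform 2 ({0, 1, 3} : Finset (Fin 4)) 3 (fun i => if i = 0 then 1 else 0)
        (⟨X 1 * ((∑ t ∈ Finset.range (m + 1), X 3 ^ (t + 1)) + X 0 + X 0 ^ 2 * X 3 ^ m + X 0 ^ 2 * X 3 ^ (m + 1)), 0, exc⟩ :
          State (ZMod 2)) := by
    unfold pointTransform
    rw [show (⟨X 1 * ((∑ t ∈ Finset.range (m + 1), X 3 ^ (t + 1)) + X 0 + X 0 ^ 2 * X 3 ^ m + X 0 ^ 2 * X 3 ^ (m + 1)), 0, exc⟩ :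
      State (ZMod 2)).F = X 1 * ((∑ t ∈ Finset.range (m + 1), X 3 ^ (t + 1)) + X 0 + X 0 ^ 2 * X 3 ^ m + X 0 ^ 2 * X 3 ^ (m + 1))
      from rfl, chartTransform_univ_F]
  have hF : deletePthPowers 2 (pointTransform 2 (Finset.univ : Finset (Fin 4)) 3 (fun i => if i = 0 then 1 else 0)
      (⟨X 1 * ((∑ t ∈ Finset.range (m + 1), X 3 ^ (t + 1)) + X 0 + X 0 ^ 2 * X 3 ^ m + X 0 ^ 2 * X 3 ^ (m + 1)), 0, exc⟩ :
        State (ZMod 2))) =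
      X 1 * ((∑ t ∈ Finset.range (m + 2), X 3 ^ (t + 1)) + X 0 + X 0 ^ 2 * X 3 ^ (m + 1) + X 0 ^ 2 * X 3 ^ (m + 2)) := by
    rw [hpt, pointTransform_F, deletePthPowers_F (m + 1)]
  have hr : newMult 2 (Finset.univ : Finset (Fin 4)) 3 (fun i => if i = 0 then 1 else 0)
      (⟨X 1 * ((∑ t ∈ Finset.range (m + 1), X 3 ^ (t + 1)) + X 0 + X 0 ^ 2 * X 3 ^ m + X 0 ^ 2 * X 3 ^ (m + 1)), 0, exc⟩ :
        State (ZMod 2)) = 0 := by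
    unfold newMult
    rw [show (⟨X 1 * ((∑ t ∈ Finset.range (m + 1), X 3 ^ (t + 1)) + X 0 + X 0 ^ 2 * X 3 ^ m + X 0 ^ 2 * X 3 ^ (m + 1)), 0, exc⟩ :
      State (ZMod 2)).r = 0 from rfl, Finsupp.filter_zero, ordAlong_univ_F]
    ext i
    rw [Finsupp.update_apply]
    split_ifs <;> rfl
  rw [show step 2 (Finset.univ : Finset (Fin 4)) 3 (fun i => if i = 0 then 1 else 0)
      (⟨X 1 * ((∑ t ∈ Finset.range (m + 1), X 3 ^ (t + 1)) + X 0 + X 0 ^ 2 * X 3 ^ m + X 0 ^ 2 * X 3 ^ (m + 1)), 0, exc⟩ :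
        State (ZMod 2)) = ⟨_, _, _⟩ from rfl, hF, hr]
  rfl

/-- The point edge to `F (m+1)` (equimultiple, non-zero). [folklore] -/
theorem edge_univ_F (m : ℕ) (exc : Finset (Fin 4)) :
    Edge 2 (Finset.univ : Finset (Fin 4))
      (⟨X 1 * ((∑ t ∈ Finset.range (m + 1), X 3 ^ (t + 1)) + X 0 + X 0 ^ 2 * X 3 ^ m + X 0 ^ 2 * X 3 ^ (m + 1)), 0, exc⟩ :
        State (ZMod 2))
      ⟨X 1 * ((∑ t ∈ Finset.range (m + 2), X 3 ^ (t + 1)) + X 0 + X 0 ^ 2 * X 3 ^ (m + 1) + X 0 ^ 2 * X 3 ^ (m + 2)), 0,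
        insert 3 (exc.filter fun i => (if i = (0 : Fin 4) then (1 : ZMod 2) else 0) = 0)⟩ := by
  refine ⟨3, (fun i => if i = 0 then 1 else 0), Finset.mem_univ _, rfl, ?_, ?_, (step_univ_F m exc).symm⟩
  · intro d hd0 hdeg
    unfold pointTransform
    rw [show (⟨X 1 * ((∑ t ∈ Finset.range (m + 1), X 3 ^ (t + 1)) + X 0 + X 0 ^ 2 * X 3 ^ m + X 0 ^ 2 * X 3 ^ (m + 1)), 0, exc⟩ :
      State (ZMod 2)).F = X 1 * ((∑ t ∈ Finset.range (m + 1), X 3 ^ (t + 1)) + X 0 + X 0 ^ 2 * X 3 ^ m + X 0 ^ 2 * X 3 ^ (m + 1))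
      from rfl, chartTransform_univ_F]
    have h := pointTransform_F m 0 exc
    unfold pointTransform at h
    rw [show (⟨X 1 * ((∑ t ∈ Finset.range (m + 1), X 3 ^ (t + 1)) + X 0 + X 0 ^ 2 * X 3 ^ m + X 0 ^ 2 * X 3 ^ (m + 1)), 0, exc⟩ :
      State (ZMod 2)).F = X 1 * ((∑ t ∈ Finset.range (m + 1), X 3 ^ (t + 1)) + X 0 + X 0 ^ 2 * X 3 ^ m + X 0 ^ 2 * X 3 ^ (m + 1))
      from rfl] at h
    rw [h]
    obtain ⟨i, rfl⟩ := eq_single_of_degree_lt_two hd0 hdeg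
    by_contra hne
    have h2 := (support_F_props (m + 1) (MvPolynomial.mem_support_iff.mpr hne)).2.2
    rw [Finsupp.degree_single] at h2
    omega
  · rw [step_univ_F]
    exact F_ne_zero (m + 1)

/-! ## 3. The trap -/

/-- The `{x₀,x₁,x₃}` edge to `F (m+1)`. [folklore] -/
theorem edge_S_F (m : ℕ) (exc : Finset (Fin 4)) :
    Edge 2 ({0, 1, 3} : Finset (Fin 4))
      (⟨X 1 * ((∑ t ∈ Finset.range (m + 1), X 3 ^ (t + 1)) + X 0 + X 0 ^ 2 * X 3 ^ m + X 0 ^ 2 * X 3 ^ (m + 1)), 0, exc⟩ :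
        State (ZMod 2))
      ⟨X 1 * ((∑ t ∈ Finset.range (m + 2), X 3 ^ (t + 1)) + X 0 + X 0 ^ 2 * X 3 ^ (m + 1) + X 0 ^ 2 * X 3 ^ (m + 2)), 0,
        insert 3 (exc.filter fun i => (if i = (0 : Fin 4) then (1 : ZMod 2) else 0) = 0)⟩ := by
  refine ⟨3, (fun i => if i = 0 then 1 else 0), by decide, rfl, ?_, ?_, (step_F m exc).symm⟩
  · intro d hd0 hdeg
    rw [pointTransform_F]
    obtain ⟨i, rfl⟩ := eq_single_of_degree_lt_two hd0 hdeg
    by_contra hne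
    have h2 := (support_F_props (m + 1) (MvPolynomial.mem_support_iff.mpr hne)).2.2
    rw [Finsupp.degree_single] at h2
    omega
  · rw [step_F]
    exact F_ne_zero (m + 1)

/-- **The divergent family (with `r = 0`) is a TRAP SET of the plain global game over `𝔽₂`.** [OURS · counted 0] [folklore] -/
theorem isTrapSet_family :
    Game.IsTrapSet (fun (t : State (ZMod 2)) (S : Finset (Fin 4)) => IsPermissibleCentre 2 S t.F)
      (fun t S t' => Edge 2 S t t')
      {s : State (ZMod 2) | s.r = 0 ∧ ∃ m : ℕ, s.F =
        X 1 * ((∑ t ∈ Finset.range (m + 1), X 3 ^ (t + 1)) + X 0 + X 0 ^ 2 * X 3 ^ m + X 0 ^ 2 * X 3 ^ (m + 1))} := by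
  rintro s ⟨hr, m, hF⟩
  have hs : s = (⟨X 1 * ((∑ t ∈ Finset.range (m + 1), X 3 ^ (t + 1)) + X 0 + X 0 ^ 2 * X 3 ^ m + X 0 ^ 2 * X 3 ^ (m + 1)), 0, s.exc⟩ :
      State (ZMod 2)) := by
    rw [show s = ⟨s.F, s.r, s.exc⟩ from rfl, hF, hr]
  refine ⟨⟨{0, 1, 3}, ?_⟩, fun S hS => ?_⟩
  · show IsPermissibleCentre 2 {0, 1, 3} s.F
    rw [hF]; exact (isMode1hCentre_F m).1
  · change IsPermissibleCentre 2 S s.F at hS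
    rw [hF] at hS
    rcases eq_of_isPermissibleCentre_F m hS with rfl | rfl
    · refine ⟨⟨X 1 * ((∑ t ∈ Finset.range (m + 2), X 3 ^ (t + 1)) + X 0 + X 0 ^ 2 * X 3 ^ (m + 1) + X 0 ^ 2 * X 3 ^ (m + 2)), 0,
        insert 3 (s.exc.filter fun i => (if i = (0 : Fin 4) then (1 : ZMod 2) else 0) = 0)⟩, ⟨rfl, m + 1, rfl⟩, ?_⟩
      rw [hs]
      exact edge_S_F m s.exc
    · refine ⟨⟨X 1 * ((∑ t ∈ Finset.range (m + 2), X 3 ^ (t + 1)) + X 0 + X 0 ^ 2 * X 3 ^ (m + 1) + X 0 ^ 2 * X 3 ^ (m + 2)), 0,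
        insert 3 (s.exc.filter fun i => (if i = (0 : Fin 4) then (1 : ZMod 2) else 0) = 0)⟩, ⟨rfl, m + 1, rfl⟩, ?_⟩
      rw [hs]
      exact edge_univ_F m s.exc

/-- **NO WINNING STRATEGY FOR A FROM THE DIVERGENT FAMILY** (plain global game over `𝔽₂`, `q = 2`), with `r = 0`. [OURS · counted 0]
[folklore] -/
theorem not_stateWins_F_zero (m : ℕ) (exc : Finset (Fin 4)) :
    ¬ StateWins 2 (⟨X 1 * ((∑ t ∈ Finset.range (m + 1), X 3 ^ (t + 1)) + X 0 + X 0 ^ 2 * X 3 ^ m + X 0 ^ 2 * X 3 ^ (m + 1)), 0, exc⟩ :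
      State (ZMod 2)) := fun h =>
  Game.Wins.not_mem_of_isTrapSet _ _ isTrapSet_family h ⟨rfl, m, rfl⟩

/-- **… and for EVERY booking** (the game reads `F` only). [OURS · counted 0] [folklore] -/
theorem not_stateWins_F (m : ℕ) (r : Fin 4 →₀ ℕ) (exc : Finset (Fin 4)) :
    ¬ StateWins 2 (⟨X 1 * ((∑ t ∈ Finset.range (m + 1), X 3 ^ (t + 1)) + X 0 + X 0 ^ 2 * X 3 ^ m + X 0 ^ 2 * X 3 ^ (m + 1)), r, exc⟩ :
      State (ZMod 2)) := fun h =>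
  not_stateWins_F_zero m exc (WinCertF.stateWins_rebook h 0 exc)

/-- **The trap is two MODE-1h edges away from the `d = 0` leaf `x₀x₁x₂x₃(1 + x₀)`** (with the booking `(0, ∅)`): the state
`⟨F 0, 0, {x₂}⟩` reached in `…UnitDivergence` is lost for A. [OURS · counted 0] [folklore] -/
theorem not_stateWins_prefix :
    ¬ StateWins 2 (⟨[(![0, 1, 0, 1], 1), (![1, 1, 0, 0], 1), (![2, 1, 0, 0], 1), (![2, 1, 0, 1], 1)], ![0, 0, 0, 0], {2}⟩ :
      SData 4 (ZMod 2)).toState := by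
  rw [prefix_toState_eq]
  exact not_stateWins_F_zero 0 {2}

end UnitDivergence

end Summit.ResolutionOfSingularities.ResolutionOfSingularities.Theorems.PIDim4

end
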